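import Summits.SmoothPoincare4.SmoothPoincare4.Theorems.SymplecticOrigamiOrigamiFoldExistenceStubOuterSideLemmaPsiLocal
import Literature.Topology.CoveringSpaces.CoveringSubsingletonFiber
import Literature.Topology.FourManifolds.SphereHypersurfaceSidesSimplyConnected
import Mathlib.Topology.Covering.Basic

/-!
# Stub `stub_outerSideLemma` of line `shadow-pleats` for crux `OrigamiFoldExistence` — ε₁:
# the SHEET through the collar over the chimney (item stmt-SmoothPoincare4-7844, route SymplecticOrigami;
# seat c5, complementary lead; skeleton r8 `Cruxes/OrigamiFoldExistence/Lines/shadow_pleats.lean`)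

First half of the degree-free proof of the outer side lemma O1 (`stub_outerSideLemma : OuterSideLemma`; paper:
`Cruxes/OrigamiFoldExistence/SideLemma-covering-c5.md` §3).  Setting: a `1`-chart pleated position `(ι, δ, e)` of a
COMPACT `M`, tube data `D` of the lifted outer crease, a cap map `C` (hypotheses `hCs hCband hCd` of file Q `…ChartPsi`),
and the BAD hypothesis that the open outer collar `e₀{2 < ‖u‖ < 2 + κ}` is lifted into the CHIMNEY `{sideσ D < 0}`
(sign `s = -poleSign D` with `0 < s · D.sideFun` on the collar).  Then:

* `exists_sheet_of_collar_chimney` — there is an OPEN set `S ⊆ Kₒ = M ∖ e₀(B̄₂)` mapped by the structure map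
  `Ψ = psiMap ι δ C` INJECTIVELY into the chimney, containing the open collar, and RELATIVELY CLOSED over the chimney
  (a point of `Kₒ` over the chimney in `closure S` lies in `S`).
  PROOF.  `Ψ` restricted to the compact `K = M ∖ e₀(B₂)` is continuous and a local homeomorphism over `Ψ⁻¹(chimney)`
  (file β `isLocalHomeomorphOn_restrict_psiMap`; the points `e₀(S₂)` of `K` go to the crease), hence a COVERING over
  the chimney (Mathlib `IsCoveringMapOn.of_isLocalHomeomorphOn`); the chimney is an open `4`-cell by Brown's generalized
  Schoenflies theorem (Literature `SphereHypersurfaceSidesSimplyConnected`: simply connected + locally path connected),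
  so the lifting criterion (`Literature.Topology.CoveringSpaces.exists_lift_isOpen_range`) gives a continuous SECTION
  through the collar point `e₀ u`; `S` is its range read in `M`: clopen in `Ψ⁻¹(chimney) ∩ K` (so it contains the
  connected collar), injective under `Ψ`, open in `M` because it lies over the open `Kₒ`.

The second half (file ε₂ `…StubOuterSideLemma`) derives the contradiction.  Sources: SideLemma-covering-c5.md §3;
A. Hatcher, *Algebraic Topology* (2002) Prop. 1.33; R. J. Daverman, *Decompositions of manifolds* (1986) Thm. II.6.6.
-/

noncomputable section

-- the prescribed namespace `Summit.<P>.<Sub>.…` duplicates `SmoothPoincare4` (P = Sub)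
set_option linter.dupNamespace false

open scoped Manifold ContDiff Topology RealInnerProductSpace
open Set Function Filter Metric
open Literature.Topology.FourManifolds Literature.Topology.FourManifolds.SphereHypersurfaceSides

namespace Summit.SmoothPoincare4.SmoothPoincare4.Theorems.OrigamiFoldExistence.ShadowPleats

section Sheet

variable {M : Type} [TopologicalSpace M] [T2Space M] [ChartedSpace (EuclideanSpace ℝ (Fin 4)) M]
  [IsManifold (𝓡 4) ∞ M]
  {ι : M → EuclideanSpace ℝ (Fin 5)} {δ : ℝ} {e : Fin 1 → EuclideanSpace ℝ (Fin 4) → M}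
  {C : EuclideanSpace ℝ (Fin 5) → Metric.sphere (0 : EuclideanSpace ℝ (Fin 5)) 1}

/-- **THE SHEET THROUGH THE COLLAR.**  If the open outer collar of a `1`-chart pleated position of a compact `M` is
lifted by the structure map `Ψ` into the chimney of the lifted outer crease, there is an open `S ⊆ M ∖ e₀(B̄₂)`
containing the collar, mapped injectively into the chimney by `Ψ`, and relatively closed over the chimney — one sheet
of the covering `Ψ|K → chimney`, produced by the lifting criterion over the simply connected chimney (Brown).
[folklore] -/
theorem exists_sheet_of_collar_chimney [CompactSpace M]
    (hpos : IsPleatedPosition ι δ e) (D : TubeData (liftedCrease ι (e 0)))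
    (hCs : ∀ p : EuclideanSpace ℝ (Fin 5), p 4 < 1 →
      ContMDiffAt 𝓘(ℝ, EuclideanSpace ℝ (Fin 5)) (𝓡 4) ∞ C p)
    (hCband : ∀ p : EuclideanSpace ℝ (Fin 5), ‖p‖ = 1 → (1 - δ) / 2 ≤ p 4 → p 4 < 1 →
      C p = liftS4 (proj5 p))
    (hCd : ∀ p : EuclideanSpace ℝ (Fin 5), ‖p‖ = 1 → p 4 ≤ 1 - δ → ∀ w : EuclideanSpace ℝ (Fin 5),
      ⟪p, w⟫ = 0 → mfderiv 𝓘(ℝ, EuclideanSpace ℝ (Fin 5)) (𝓡 4) C p w = 0 → w = 0)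
    {κ s : ℝ} (hsneg : s = -poleSign D)
    (hside : ∀ u : EuclideanSpace ℝ (Fin 4), 2 < ‖u‖ → ‖u‖ < 2 + κ →
      0 < s * D.sideFun (liftS4 ((proj5 ∘ ι ∘ e 0) u)))
    {u : EuclideanSpace ℝ (Fin 4)} (hu2 : 2 < ‖u‖) (huκ : ‖u‖ < 2 + κ) :
    ∃ S : Set M, IsOpen S ∧ S ⊆ {m : M | m ∉ e 0 '' Metric.closedBall 0 2} ∧
      (∀ m ∈ S, psiMap ι δ C m ∈ chimney D) ∧ Set.InjOn (psiMap ι δ C) S ∧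
      (∀ v : EuclideanSpace ℝ (Fin 4), 2 < ‖v‖ → ‖v‖ < 2 + κ → e 0 v ∈ S) ∧
      (∀ m : M, m ∉ e 0 '' Metric.closedBall 0 2 → psiMap ι δ C m ∈ chimney D → m ∈ closure S → m ∈ S) := by
  set G : EuclideanSpace ℝ (Fin 4) → EuclideanSpace ℝ (Fin 4) := proj5 ∘ ι ∘ e 0 with hGdef
  have hN : northPole ∉ range (liftedCrease ι (e 0)) := northPole_notMem_range_liftedCrease ι (e 0)
  have hpos' := hpos
  obtain ⟨hι, hδ, hδ1, hround, hcharts, -, -, -⟩ := hpos'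
  have he : Manifold.IsSmoothEmbedding (𝓡 4) (𝓡 4) ∞ (e 0) := (hcharts 0).1
  have heinj : Injective (e 0) := he.isEmbedding.injective
  have hecont : Continuous (e 0) := he.contMDiff.continuous
  have heopen : IsOpenMap (e 0) := isOpenMap_pleatChart he
  have habove : ∀ v, 1 - δ < ι (e 0 v) 4 := (hcharts 0).2
  -- the structure map
  set Ψ : M → Metric.sphere (0 : EuclideanSpace ℝ (Fin 5)) 1 := psiMap ι δ C with hΨdef
  have hΨcont : Continuous Ψ := (contMDiff_psiMap hι hδ hδ1 hround hCs hCband).continuous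
  have hΨe : ∀ v, Ψ (e 0 v) = liftS4 (G v) := fun v => psiMap_of_lt (habove v)
  have hcrease : ∀ v : EuclideanSpace ℝ (Fin 4), ‖v‖ = 2 → liftS4 (G v) ∈ range (liftedCrease ι (e 0)) := by
    intro v hv
    rw [range_liftedCrease]
    exact ⟨v, mem_sphere_zero_iff_norm.2 hv, rfl⟩
  have hpole := poleSign_eq_or D hN
  -- BAD CASE: the collar goes into the chimney `{sideσ < 0} = {0 < s * sideFun}`
  have hchim : ∀ z, z ∈ chimney D ↔ 0 < s * D.sideFun z := by
    intro z
    show poleSign D * D.sideFun z < 0 ↔ 0 < s * D.sideFun z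
    rw [hsneg, neg_mul, neg_pos]
  have hcollar_chim : ∀ v : EuclideanSpace ℝ (Fin 4), 2 < ‖v‖ → ‖v‖ < 2 + κ → Ψ (e 0 v) ∈ chimney D := by
    intro v hv2 hvκ
    rw [hΨe, hchim]
    exact hside v hv2 hvκ
  /- ### the compact piece `K = M ∖ e₀(B₂)` and its open part `Kₒ = M ∖ e₀(B̄₂)` -/
  set K : Set M := {m | m ∉ e 0 '' Metric.ball 0 2} with hKdef
  set Kₒ : Set M := {m | m ∉ e 0 '' Metric.closedBall 0 2} with hKₒdef
  have hKₒK : Kₒ ⊆ K := fun m hm h => hm (image_mono ball_subset_closedBall h)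
  have hKclosed : IsClosed K := (heopen _ isOpen_ball).isClosed_compl
  have hKₒopen : IsOpen Kₒ := ((isCompact_closedBall (0 : EuclideanSpace ℝ (Fin 4)) 2).image hecont).isClosed.isOpen_compl
  haveI : CompactSpace K := isCompact_iff_compactSpace.1 hKclosed.isCompact
  -- chart points of norm `≥ 2` are in `K`, of norm `> 2` in `Kₒ`
  have heK : ∀ v : EuclideanSpace ℝ (Fin 4), 2 ≤ ‖v‖ → e 0 v ∈ K := by
    rintro v hv ⟨v', hv', hvv'⟩
    rw [heinj hvv'] at hv'
    exact absurd (mem_ball_zero_iff.1 hv') (not_lt.2 hv)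
  have heKₒ : ∀ v : EuclideanSpace ℝ (Fin 4), 2 < ‖v‖ → e 0 v ∈ Kₒ := by
    rintro v hv ⟨v', hv', hvv'⟩
    rw [heinj hvv'] at hv'
    exact absurd (mem_closedBall_zero_iff.1 hv') (not_le.2 hv)
  -- a point of `K ∖ Kₒ` is a chart point of norm exactly `2`
  have hKsphere : ∀ m ∈ K, m ∉ Kₒ → ∃ v : EuclideanSpace ℝ (Fin 4), ‖v‖ = 2 ∧ e 0 v = m := by
    intro m hmK hmKₒ
    simp only [hKₒdef, mem_setOf_eq, not_not] at hmKₒ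
    obtain ⟨v, hv, rfl⟩ := hmKₒ
    refine ⟨v, le_antisymm (mem_closedBall_zero_iff.1 hv) ?_, rfl⟩
    by_contra hlt
    exact hmK ⟨v, mem_ball_zero_iff.2 (not_le.1 hlt), rfl⟩
  /- ### `F = Ψ|K` is a covering over the chimney -/
  set F : K → Metric.sphere (0 : EuclideanSpace ℝ (Fin 5)) 1 := fun k => Ψ k with hFdef
  have hFcont : Continuous F := hΨcont.comp continuous_subtype_val
  have hpre : F ⁻¹' chimney D ⊆ {k : K | (k : M) ∈ Kₒ} := by
    intro k hk
    by_contra hkₒ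
    obtain ⟨v, hv, hkv⟩ := hKsphere k k.2 hkₒ
    have hFk : F k ∈ range (liftedCrease ι (e 0)) := by
      show Ψ k ∈ _
      rw [← hkv, hΨe]
      exact hcrease v hv
    exact (disjoint_chimney_range D hN).le_bot ⟨hk, hFk⟩
  have hloc : IsLocalHomeomorphOn F (F ⁻¹' chimney D) :=
    (isLocalHomeomorphOn_restrict_psiMap hpos hCs hCband hCd).mono hpre
  have hcov : IsCoveringMapOn F (chimney D) := IsCoveringMapOn.of_isLocalHomeomorphOn hFcont hloc
  have hcov' : IsCoveringMap ((chimney D).restrictPreimage F) := hcov.isCoveringMap_restrictPreimage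
  set F' : F ⁻¹' chimney D → chimney D := (chimney D).restrictPreimage F with hF'def
  have hF'cont : Continuous F' := hFcont.restrictPreimage
  have hF'val : ∀ w : F ⁻¹' chimney D, ((F' w : chimney D) : Metric.sphere (0 : EuclideanSpace ℝ (Fin 5)) 1)
      = Ψ ((w : K) : M) := fun w => rfl
  /- ### the chimney is simply connected and locally path connected (Brown) -/
  haveI : SimplyConnectedSpace (chimney D) := by
    rcases hpole with hp | hp
    · have hset : chimney D = {z | D.sideFun z < 0} := by
        ext z; simp [chimney, sideσ, hp]
      rw [hset]
      exact D.simplyConnectedSpace_setOf_sideFun_neg (by norm_num)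
    · have hset : chimney D = {z | 0 < D.sideFun z} := by
        ext z; simp [chimney, sideσ, hp]
      rw [hset]
      exact D.simplyConnectedSpace_setOf_sideFun_pos (by norm_num)
  haveI : LocallyPathConnectedSpace (chimney D) := by
    rcases hpole with hp | hp
    · have hset : chimney D = {z | D.sideFun z < 0} := by
        ext z; simp [chimney, sideσ, hp]
      rw [hset]
      exact D.locallyPathConnectedSpace_setOf_sideFun_neg (by norm_num)
    · have hset : chimney D = {z | 0 < D.sideFun z} := by
        ext z; simp [chimney, sideσ, hp]
      rw [hset]
      exact D.locallyPathConnectedSpace_setOf_sideFun_pos (by norm_num)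
  /- ### the section through the collar point `e₀ u` -/
  have huK : e 0 u ∈ K := heK u hu2.le
  have huchim : Ψ (e 0 u) ∈ chimney D := hcollar_chim u hu2 huκ
  set k₁ : K := ⟨e 0 u, huK⟩ with hk₁def
  have hk₁ : k₁ ∈ F ⁻¹' chimney D := huchim
  set v₁ : F ⁻¹' chimney D := ⟨k₁, hk₁⟩ with hv₁def
  set c₁ : chimney D := ⟨Ψ (e 0 u), huchim⟩ with hc₁def
  have hFv₁ : F' v₁ = id c₁ := rfl
  obtain ⟨σ₁, hσF, hσv₁, hσopen⟩ :=
    Literature.Topology.CoveringSpaces.exists_lift_isOpen_range hcov' (ι := (id : chimney D → chimney D))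
      Topology.IsEmbedding.id hFv₁
  have hF'σ : ∀ c, F' (σ₁ c) = c := fun c => congr_fun hσF c
  -- the sheet `S = range σ₁` is open and closed in `V = F ⁻¹' chimney`
  have hSopen : IsOpen (range σ₁ : Set (F ⁻¹' chimney D)) := by
    have huniv : F' ⁻¹' range (id : chimney D → chimney D) = univ := by
      rw [Set.range_id, preimage_univ]
    have hemb : Topology.IsOpenEmbedding ((↑) : (F' ⁻¹' range (id : chimney D → chimney D)) → F ⁻¹' chimney D) :=
      IsOpen.isOpenEmbedding_subtypeVal (by rw [huniv]; exact isOpen_univ)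
    have himg := hemb.isOpenMap _ hσopen
    rwa [image_preimage_eq_inter_range, Subtype.range_coe, huniv, inter_univ] at himg
  have hSclosed : IsClosed (range σ₁ : Set (F ⁻¹' chimney D)) := by
    have hS : (range σ₁ : Set (F ⁻¹' chimney D)) = {w | σ₁ (F' w) = w} := by
      ext w
      constructor
      · rintro ⟨c, rfl⟩
        show σ₁ (F' (σ₁ c)) = σ₁ c
        rw [hF'σ]
      · intro hw
        exact ⟨F' w, hw⟩
    rw [hS]
    exact isClosed_eq (σ₁.continuous.comp hF'cont) continuous_id
  have hSclopen : IsClopen (range σ₁ : Set (F ⁻¹' chimney D)) := ⟨hSclosed, hSopen⟩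
  /- ### the sheet as a subset of `M` -/
  set π : F ⁻¹' chimney D → M := fun w => ((w : K) : M) with hπdef
  have hπind : Topology.IsInducing π := Topology.IsInducing.subtypeVal.comp Topology.IsInducing.subtypeVal
  have hπinj : Injective π := Subtype.val_injective.comp Subtype.val_injective
  have hπcont : Continuous π := continuous_subtype_val.comp continuous_subtype_val
  set S : Set M := π '' range σ₁ with hSdef
  have hSK : S ⊆ K := by
    rintro _ ⟨w, -, rfl⟩
    exact (w : K).2
  have hSchim : ∀ m ∈ S, Ψ m ∈ chimney D := by
    rintro _ ⟨w, -, rfl⟩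
    exact w.2
  have hSKₒ : S ⊆ Kₒ := by
    rintro _ ⟨w, -, rfl⟩
    exact hpre w.2
  -- `Ψ` is injective on the sheet
  have hSinj : InjOn Ψ S := by
    rintro _ ⟨w, ⟨c, rfl⟩, rfl⟩ _ ⟨w', ⟨c', rfl⟩, rfl⟩ hΨ
    have hcc : c = c' := by
      apply Subtype.ext
      rw [← hF'σ c, ← hF'σ c']
      exact hΨ
    rw [hcc]
  -- the sheet is open in `M` (it lies over the open `Kₒ`)
  have hSopenM : IsOpen S := by
    -- `range σ₁` is open in `V`, `V` is open in `K`; so `S = U ∩ K` for an open `U ⊆ M`, and `S ⊆ Kₒ` open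
    have hVopen : IsOpen (F ⁻¹' chimney D) := (isOpen_chimney D hN).preimage hFcont
    have h1 : IsOpen ((↑) '' range σ₁ : Set K) := hVopen.isOpenEmbedding_subtypeVal.isOpenMap _ hSopen
    obtain ⟨U, hU, hUK⟩ := isOpen_induced_iff.1 h1
    have hSU : S = U ∩ Kₒ := by
      ext m
      constructor
      · intro hm
        refine ⟨?_, hSKₒ hm⟩
        obtain ⟨w, hw, rfl⟩ := hm
        have : (w : K) ∈ ((↑) : K → M) ⁻¹' U := by
          rw [hUK]
          exact ⟨w, hw, rfl⟩
        exact this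
      · rintro ⟨hmU, hmKₒ⟩
        have : (⟨m, hKₒK hmKₒ⟩ : K) ∈ ((↑) : K → M) ⁻¹' U := hmU
        rw [hUK] at this
        obtain ⟨w, hw, hwm⟩ := this
        exact ⟨w, hw, congrArg Subtype.val hwm⟩
    rw [hSU]
    exact hU.inter hKₒopen
  /- ### the open collar lies in the sheet -/
  set Ω : Set M := e 0 '' {v | 2 < ‖v‖ ∧ ‖v‖ < 2 + κ} with hΩdef
  have hΩS : Ω ⊆ S := by
    -- lift `Ω` to `V`
    set ΩV : Set (F ⁻¹' chimney D) := π ⁻¹' Ω with hΩVdef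
    have hπΩ : π '' ΩV = Ω := by
      apply Subset.antisymm (image_preimage_subset _ _)
      rintro _ ⟨v, hv, rfl⟩
      have hvK : e 0 v ∈ K := heK v hv.1.le
      have hvchim : (⟨e 0 v, hvK⟩ : K) ∈ F ⁻¹' chimney D := hcollar_chim v hv.1 hv.2
      exact ⟨⟨⟨e 0 v, hvK⟩, hvchim⟩, ⟨v, hv, rfl⟩, rfl⟩
    have hΩVpre : IsPreconnected ΩV := by
      rw [← hπind.isPreconnected_image, hπΩ]
      exact (isPreconnected_openShell two_pos).image _ hecont.continuousOn
    have hmeet : (ΩV ∩ range σ₁).Nonempty := by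
      refine ⟨v₁, ?_, ⟨c₁, ?_⟩⟩
      · show e 0 u ∈ Ω
        exact ⟨u, ⟨hu2, huκ⟩, rfl⟩
      · exact hσv₁
    have hsub : ΩV ⊆ range σ₁ := hΩVpre.subset_isClopen hSclopen hmeet
    rw [← hπΩ]
    exact image_mono hsub
  have heΩ : ∀ v : EuclideanSpace ℝ (Fin 4), 2 < ‖v‖ → ‖v‖ < 2 + κ → e 0 v ∈ S :=
    fun v hv2 hvκ => hΩS ⟨v, ⟨hv2, hvκ⟩, rfl⟩
  -- relatively closed over the chimney: `range σ₁` is closed in `V`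
  have hSclch : ∀ m : M, m ∈ Kₒ → Ψ m ∈ chimney D → m ∈ closure S → m ∈ S := by
    intro m hmKₒ hch hmcl
    set w : F ⁻¹' chimney D := ⟨⟨m, hKₒK hmKₒ⟩, hch⟩ with hwdef
    have hwcl : w ∈ closure (range σ₁) := by
      rw [hπind.closure_eq_preimage_closure_image]
      exact hmcl
    rw [hSclosed.closure_eq] at hwcl
    exact ⟨w, hwcl, rfl⟩
  exact ⟨S, hSopenM, hSKₒ, hSchim, hSinj, heΩ, hSclch⟩

end Sheet

end Summit.SmoothPoincare4.SmoothPoincare4.Theorems.OrigamiFoldExistence.ShadowPleats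

end
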